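import Summits.ResolutionOfSingularities.ResolutionOfSingularities.Theorems.FrobeniusLadderFInjectiveMacaulayficationX2YGCentre
import Literature.AlgebraicGeometry.Resolution.AffineBlowupReductionCover
import HarnessLib

/-!
# The blowing up of the rank-one double-point family `x′² + y·g = 0` along its singular locus `(x′, y, g)` IS REGULAR, and `Sing = V(x′, y, g)` — in EVERY characteristic
# (T″-side second kernel instance (RR-I2), generic package part 2; crux `FInjectiveMacaulayfication` stmt-ResolutionOfSingularities-15315, chain w45a; bed memo
# `Cruxes/…/Lines/RR-I2-bed-x2y3u3t3s3.md`; template = res-L1-w45a-stub-1's `ODPCurveBlowupRegular`; seat res-L1-w45a-lead-1 g11)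

[OURS · L1 W4.5a] Support file (`--supports stmt-ResolutionOfSingularities-15315 --as helper`); replaces the role of NO printed item; NOT a statement of any
manuscript; def-free; UNCONDITIONAL; commutative algebra + one scheme sentence. AI-written (AI review is weaker than expert review).

SETTING (generic, as in `X2YGCentre`). `Λ` a REGULAR ring with a derivation `D₀` (over any base `S₀`) such that `D₀ g` is a unit modulo `g`, and `Λ/(g)` a domain
(so `Λ/(g)` is a regular domain, Stacks 07PF); `R = Λ[T₀, T₁]`, `cen = (T₀, T₁, C g)`, `I = (cen)`, `h = T₀² + T₁·C g`, `C = R/(h)`, `J = I·C`.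
NO HYPOTHESIS ON THE CHARACTERISTIC: the derivative `∂_{T₀} h = 2T₀` is never used — at a prime containing `T₁` and `g` the equation itself puts `T₀² ∈ 𝔓`.
* §1 `pderiv_one_h` (`∂_{T₁} h = C g`), `coeffwiseDerivation_h` (`D̃₀ h = T₁ · C(D₀ g)`).
* §2 `hoff_one` — `R[1/T₁]/(h)` is regular: at `Q ∋ h`, if `C g ∉ Q` use `∂_{T₁}`, else `D̃₀ h = T₁·C(D₀ g) ∉ Q` (`T₁` a unit, `D₀ g·s = 1 + g·t`); `hoff_two` — `R[1/g]/(h)`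
  is regular (`∂_{T₁} h = C g` a unit).
* §3 `isRegularRing_chart` — the two graph-type chart rings `R[I/T₁]/(g/T₁ + (T₀/T₁)²)`, `R[I/g]/(T₁/g + (T₀/g)²)` are regular
  (`StrictTransformGraphType.isRegularRing_quotient_odp` at `(p,p′,q,q′) = (1,2,0,0), (2,1,0,0)`).
* §4 `isRegularRing_blowupAlgebra_map_of_chart` (GW 13.96 (2): `C[J/c̄_p]` IS `R[I/cen p]/(h′_p)`), ★★ `isRegularRing_blowupAlgebra_strictTransform` — `C[J/ȳ]` and
  `C[J/ḡ]` are regular rings; ★ generic `isRegular_affineBlowup_of_sq_eq_neg_mul` — for ANY ring `A` and `c : Fin 3 → A` with `c₀² = −c₁c₂`, `Bl_{(c)} Spec A` is a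
  regular scheme as soon as the two chart rings `A[(c)/c₁]`, `A[(c)/c₂]` are (`(c₁, c₂)` is a reduction, `X2YGCentre.sq_le_span_mul_of_sq_eq` +
  `affineBlowup.isRegular_of_isRegularRing_blowupAlgebra_of_pow_le`); ★★ `isRegular_affineBlowup_strictTransform` — **`Bl_J Spec C` IS A REGULAR SCHEME**.
* §5 `map_le_of_not_isRegularLocalRing` — a prime `P` of `C` with `C_P` not regular contains `J` (Stacks 07PF with `∂_{T₁}`, `D̃₀`, and `T₀² = h − T₁·C g`);
  `not_isRegularLocalRing_iff_map_le` — **`Sing(Spec C) = V(J)`**; `isPrime_map_span_cen` — `J` is prime (`C/J ≅ Λ/(g)`).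
On the point floor of the (RR-I2) bed (`Λ = k[u′,t′,s′]`, `g = 1 + u′³ + t′³ + s′³`, `3 ≠ 0`, `D₀` = Euler) this is the regularity of the blowing up of the `y`-chart of
`Bl_𝔪 {x² + y³ + u³ + t³ + s³}` along its singular surface `Σ` — next file. [folklore; cite: Liu2002, Thm. 8.1.19 (a)] [cite: StacksProject, Tag 07PF; Tag 0BIQ]
[cite: GortzWedhorn2020, Prop. 13.96 (2), Prop. 13.91 (4), (13.19)]
-/

-- single-problem summit: the doubled namespace component is forced
set_option linter.dupNamespace false

noncomputable section

namespace Summit.ResolutionOfSingularities.ResolutionOfSingularities.Theorems.FInjectiveMacaulayfication.X2YGBlowupRegular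

open MvPolynomial Literature.AlgebraicGeometry.Resolution AlgebraicGeometry
open Summit.ResolutionOfSingularities.ResolutionOfSingularities.Theorems.FInjectiveMacaulayfication
open Summit.ResolutionOfSingularities.ResolutionOfSingularities.Cruxes.EquisingularLiftNat.Sections (prime_algebraMap_of_isQuasiRegular)

universe u v

variable {Λ : Type u} [CommRing Λ] (g : Λ) (cen : Fin 3 → MvPolynomial (Fin 2) Λ) (h : MvPolynomial (Fin 2) Λ)

/-! ## §1 The two derivatives that matter -/

/-- `∂_{T₁} h = C g`. [plumbing] -/
theorem pderiv_one_h (hh : h = X 0 ^ 2 + X 1 * C g) :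
    (pderiv 1 : Derivation Λ (MvPolynomial (Fin 2) Λ) (MvPolynomial (Fin 2) Λ)) h = C g := by
  subst hh
  simp only [map_add, Derivation.leibniz, Derivation.leibniz_pow, pderiv_X_self, pderiv_X_of_ne (show (0 : Fin 2) ≠ 1 by decide),
    pderiv_C, smul_eq_mul, mul_zero, smul_zero, mul_one, zero_add]

/-- `D̃₀ h = T₁ · C(D₀ g)` for the coefficientwise extension `D̃₀` of a derivation `D₀` of `Λ` (it kills the variables). [plumbing] -/
theorem coeffwiseDerivation_h {S₀ : Type v} [CommRing S₀] [Algebra S₀ Λ] (D₀ : Derivation S₀ Λ Λ) (hh : h = X 0 ^ 2 + X 1 * C g) :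
    coeffwiseDerivation (ι := Fin 2) D₀ h = X 1 * C (D₀ g) := by
  subst hh
  simp only [map_add, Derivation.leibniz, Derivation.leibniz_pow, coeffwiseDerivation_X, coeffwiseDerivation_C, smul_eq_mul, mul_zero,
    smul_zero, add_zero, zero_add]

/-- `1 = C(D₀ g)·C s − C g·C t` in `R` from `D₀ g·s = 1 + g·t`. [plumbing] -/
theorem C_sub_eq_one {s t : Λ} {D : Λ} (hst : D * s = 1 + g * t) : (C D * C s - C g * C t : MvPolynomial (Fin 2) Λ) = 1 := by
  rw [← map_mul, ← map_mul, ← map_sub, hst, add_sub_cancel_right, map_one]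

/-! ## §2 The hypersurface `h` is regular off `V(T₁)` and off `V(C g)` -/

/-- ★ **`hoff` on the chart `T₁ = y`**: `R[1/T₁]/(h)` is a regular ring. At a prime `Q ∋ h` of `L = R[1/T₁]`: if `C g ∉ Q` the value `∂_{T₁} h = C g` works; if
`C g ∈ Q` the coefficientwise extension of `D₀` has value `T₁·C(D₀ g) ∉ Q` (`T₁` is a unit, and `C(D₀ g) ∈ Q` would put `1 = C(D₀g)C s − C g C t ∈ Q`).
NO use of `∂_{T₀}` — characteristic-free. [folklore; cite: StacksProject, Tag 07PF] -/
theorem hoff_one [IsRegularRing Λ] {S₀ : Type v} [CommRing S₀] [Algebra S₀ Λ] (D₀ : Derivation S₀ Λ Λ)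
    (hD₀ : IsUnit (Ideal.Quotient.mk (Ideal.span {g}) (D₀ g))) (hcen : cen = ![X 0, X 1, C g]) (hh : h = X 0 ^ 2 + X 1 * C g) :
    IsRegularRing (Localization.Away (cen 1) ⧸ Ideal.span {algebraMap (MvPolynomial (Fin 2) Λ) (Localization.Away (cen 1)) (cen 1 * cen 2 + cen 0 * cen 0)}) := by
  obtain ⟨-, h1, -⟩ := X2YGCentre.cen_apply g cen hcen
  obtain ⟨s, t, hst⟩ := ODPCurveBlowupRegular.exists_mul_eq_one_add g D₀ hD₀
  rw [← (X2YGCentre.h_eq_odp g cen h hcen hh).1]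
  refine ODPCurveBlowupRegular.isRegularRing_localization_quotient_of_derivations (S₀ := S₀) (Submonoid.powers (cen 1)) h fun Q hQ _ => ?_
  by_cases hgQ : algebraMap (MvPolynomial (Fin 2) Λ) (Localization.Away (cen 1)) (C g) ∈ Q
  · refine ⟨coeffwiseDerivation (ι := Fin 2) D₀, ?_⟩
    rw [coeffwiseDerivation_h g h D₀ hh, map_mul]
    intro hmem
    have hu : IsUnit (algebraMap (MvPolynomial (Fin 2) Λ) (Localization.Away (cen 1)) (X 1)) := by
      rw [← h1]; exact IsLocalization.Away.algebraMap_isUnit (cen 1)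
    have hDg : algebraMap (MvPolynomial (Fin 2) Λ) (Localization.Away (cen 1)) (C (D₀ g)) ∈ Q :=
      (hQ.mem_or_mem hmem).resolve_left (ODPCurveBlowupRegular.not_mem_of_isUnit hQ hu)
    apply hQ.ne_top
    rw [Ideal.eq_top_iff_one]
    have h1' : algebraMap (MvPolynomial (Fin 2) Λ) (Localization.Away (cen 1)) (C (D₀ g)) *
          algebraMap (MvPolynomial (Fin 2) Λ) (Localization.Away (cen 1)) (C s) -
        algebraMap (MvPolynomial (Fin 2) Λ) (Localization.Away (cen 1)) (C g) *
          algebraMap (MvPolynomial (Fin 2) Λ) (Localization.Away (cen 1)) (C t) = 1 := by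
      have := congrArg (algebraMap (MvPolynomial (Fin 2) Λ) (Localization.Away (cen 1))) (C_sub_eq_one g hst)
      simpa only [map_sub, map_mul, map_one] using this
    rw [← h1']
    exact Q.sub_mem (Q.mul_mem_right _ hDg) (Q.mul_mem_right _ hgQ)
  · exact ⟨(pderiv 1 : Derivation Λ (MvPolynomial (Fin 2) Λ) (MvPolynomial (Fin 2) Λ)).restrictScalars S₀,
      by rw [Derivation.restrictScalars_apply, pderiv_one_h g h hh]; exact hgQ⟩

/-- **`hoff` on the chart `C g`**: `R[1/g]/(h)` is a regular ring (`∂_{T₁} h = C g` is a unit there). [folklore; cite: StacksProject, Tag 07PF] -/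
theorem hoff_two [IsRegularRing Λ] (hcen : cen = ![X 0, X 1, C g]) (hh : h = X 0 ^ 2 + X 1 * C g) :
    IsRegularRing (Localization.Away (cen 2) ⧸ Ideal.span {algebraMap (MvPolynomial (Fin 2) Λ) (Localization.Away (cen 2)) (cen 2 * cen 1 + cen 0 * cen 0)}) := by
  obtain ⟨-, -, h2⟩ := X2YGCentre.cen_apply g cen hcen
  rw [← (X2YGCentre.h_eq_odp g cen h hcen hh).2]
  refine ODPCurveBlowupRegular.isRegularRing_localization_quotient_of_derivations (S₀ := Λ) (Submonoid.powers (cen 2)) h fun Q hQ _ => ⟨pderiv 1, ?_⟩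
  rw [pderiv_one_h g h hh, ← h2]
  exact ODPCurveBlowupRegular.not_mem_of_isUnit hQ (IsLocalization.Away.algebraMap_isUnit (cen 2))

/-! ## §3 The two chart instances of `StrictTransformGraphType.isRegularRing_quotient_odp` -/

/-- ★ **The two chart rings `R[I/T₁]/(h′₁)`, `R[I/g]/(h′₂)` are regular rings** (`h′₁ = g/T₁ + (T₀/T₁)²`, `h′₂ = T₁/g + (T₀/g)²`, the graph-type strict transforms of `h`;
`Λ` regular, `D₀ g` a unit mod `g`, `Λ/(g)` a domain). [folklore; cite: Liu2002, Thm. 8.1.19 (a); StacksProject, Tag 0BIQ] -/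
theorem isRegularRing_chart [IsRegularRing Λ] [IsDomain (Λ ⧸ Ideal.span {g})] (hg : IsSMulRegular Λ g) {S₀ : Type v} [CommRing S₀] [Algebra S₀ Λ]
    (D₀ : Derivation S₀ Λ Λ) (hD₀ : IsUnit (Ideal.Quotient.mk (Ideal.span {g}) (D₀ g))) (hcen : cen = ![X 0, X 1, C g])
    (hh : h = X 0 ^ 2 + X 1 * C g) :
    IsRegularRing (blowupAlgebra (Ideal.span (Set.range cen)) (cen 1) ⧸
        Ideal.span {blowupAlgebra.frac cen 1 2 + blowupAlgebra.frac cen 1 0 * blowupAlgebra.frac cen 1 0}) ∧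
      IsRegularRing (blowupAlgebra (Ideal.span (Set.range cen)) (cen 2) ⧸
        Ideal.span {blowupAlgebra.frac cen 2 1 + blowupAlgebra.frac cen 2 0 * blowupAlgebra.frac cen 2 0}) := by
  haveI : IsRegularRing (Λ ⧸ Ideal.span {g}) := isRegularRing_quotient_of_derivation g D₀ hD₀
  haveI := X2YGCentre.isDomain_quotient g cen hcen
  haveI := X2YGCentre.isRegularRing_quotient g cen hcen
  have hx := X2YGCentre.isQuasiRegular_cen g cen hcen hg
  refine ⟨?_, ?_⟩
  · exact StrictTransformGraphType.isRegularRing_quotient_odp cen hx 1 2 0 0 (by decide) (by decide) (by decide) (by decide) (by decide)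
      (hoff_one g cen h D₀ hD₀ hcen hh)
  · exact StrictTransformGraphType.isRegularRing_quotient_odp cen hx 2 1 0 0 (by decide) (by decide) (by decide) (by decide) (by decide)
      (hoff_two g cen h hcen hh)

/-! ## §4 The strict transform: the two chart rings of `Bl_J Spec C` are regular; `Bl_J Spec C` is a regular scheme -/

/-- **One chart of the blowing up of `C = R/(h)` along `J = I·C` is a regular ring**, given the regularity of the corresponding graph-type quotient
`R[I/cen p]/(h′_p)`: the chart ring `C[J/c̄_p]` IS `R[I/cen p]/(h′_p)` (`BlowupAlgebraStrictTransform.quotientKerBlowupAlgebraMapEquiv` with `h = (cen p)²·h′_p`,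
`cen p` prime in `R[I/cen p]`, `cen p ∤ h′_p`). [cite: GortzWedhorn2020, Prop. 13.96 (2) and p. 416] [cite: StacksProject, Tag 0BIQ] -/
theorem isRegularRing_blowupAlgebra_map_of_chart [IsDomain (Λ ⧸ Ideal.span {g})] (hg : IsSMulRegular Λ g) (hcen : cen = ![X 0, X 1, C g])
    (J : Ideal (MvPolynomial (Fin 2) Λ ⧸ Ideal.span {h})) (hJ : J = (Ideal.span (Set.range cen)).map (Ideal.Quotient.mk (Ideal.span {h})))
    (p p' q q' : Fin 3) (hp' : p' ≠ p) (hq : q ≠ p) (hq' : q' ≠ p) (hqp' : q ≠ p') (hq'p' : q' ≠ p') (hodp : h = cen p * cen p' + cen q * cen q')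
    (hr : IsRegularRing (blowupAlgebra (Ideal.span (Set.range cen)) (cen p) ⧸
      Ideal.span {blowupAlgebra.frac cen p p' + blowupAlgebra.frac cen p q * blowupAlgebra.frac cen p q'})) :
    IsRegularRing (blowupAlgebra J (Ideal.Quotient.mk (Ideal.span {h}) (cen p))) := by
  haveI := X2YGCentre.isDomain_quotient g cen hcen
  have hx := X2YGCentre.isQuasiRegular_cen g cen hcen hg
  have hI : Ideal.span (Set.range cen) ≠ ⊤ := fun htop =>
    (Ideal.Quotient.zero_ne_one_iff.mp (zero_ne_one' (MvPolynomial (Fin 2) Λ ⧸ Ideal.span (Set.range cen)))) htop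
  have hf : algebraMap (MvPolynomial (Fin 2) Λ) (blowupAlgebra (Ideal.span (Set.range cen)) (cen p)) h =
      algebraMap (MvPolynomial (Fin 2) Λ) (blowupAlgebra (Ideal.span (Set.range cen)) (cen p)) (cen p) ^ 2 *
        (blowupAlgebra.frac cen p p' + blowupAlgebra.frac cen p q * blowupAlgebra.frac cen p q') := by
    rw [hodp]; exact StrictTransformGraphType.algebraMap_odp_eq cen p p' q q'
  have hprime := prime_algebraMap_of_isQuasiRegular cen p hx
  have hndvd := StrictTransformGraphType.not_dvd_odp cen hx hI p p' q q' hp' hq hq' hqp' hq'p'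
  subst hJ
  haveI := hr
  exact IsRegularRing.of_ringEquiv (R := blowupAlgebra (Ideal.span (Set.range cen)) (cen p) ⧸
      Ideal.span {blowupAlgebra.frac cen p p' + blowupAlgebra.frac cen p q * blowupAlgebra.frac cen p q'})
    (quotientKerBlowupAlgebraMapEquiv (Ideal.Quotient.mk (Ideal.span {h}))
      ((Ideal.span (Set.range cen)).map (Ideal.Quotient.mk (Ideal.span {h}))) Ideal.Quotient.mk_surjective le_rfl le_rfl
      Ideal.mk_ker hf hprime hndvd)

/-- ★★ **THE CHART RINGS `C[J/ȳ]` AND `C[J/ḡ]` OF THE BLOWING UP OF `C = R/(h)` ALONG `J = (x′, y, g)·C` ARE REGULAR RINGS** (`Λ` regular, `Λ/(g)` a domain, `g` a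
non-zero-divisor, `D₀ g` a unit modulo `g` for some derivation `D₀` of `Λ`; ANY characteristic). [folklore; cite: Liu2002, Thm. 8.1.19 (a)] [cite: GortzWedhorn2020, Prop. 13.96 (2)] -/
theorem isRegularRing_blowupAlgebra_strictTransform [IsRegularRing Λ] [IsDomain (Λ ⧸ Ideal.span {g})] (hg : IsSMulRegular Λ g)
    {S₀ : Type v} [CommRing S₀] [Algebra S₀ Λ] (D₀ : Derivation S₀ Λ Λ) (hD₀ : IsUnit (Ideal.Quotient.mk (Ideal.span {g}) (D₀ g)))
    (hcen : cen = ![X 0, X 1, C g]) (hh : h = X 0 ^ 2 + X 1 * C g)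
    (J : Ideal (MvPolynomial (Fin 2) Λ ⧸ Ideal.span {h})) (hJ : J = (Ideal.span (Set.range cen)).map (Ideal.Quotient.mk (Ideal.span {h}))) :
    IsRegularRing (blowupAlgebra J (Ideal.Quotient.mk (Ideal.span {h}) (cen 1))) ∧
      IsRegularRing (blowupAlgebra J (Ideal.Quotient.mk (Ideal.span {h}) (cen 2))) := by
  obtain ⟨r1, r2⟩ := isRegularRing_chart g cen h hg D₀ hD₀ hcen hh
  obtain ⟨e1, e2⟩ := X2YGCentre.h_eq_odp g cen h hcen hh
  exact ⟨isRegularRing_blowupAlgebra_map_of_chart g cen h hg hcen J hJ 1 2 0 0 (by decide) (by decide) (by decide) (by decide) (by decide) e1 r1,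
    isRegularRing_blowupAlgebra_map_of_chart g cen h hg hcen J hJ 2 1 0 0 (by decide) (by decide) (by decide) (by decide) (by decide) e2 r2⟩

/-- ★ **Generic: `Bl_{(c₀, c₁, c₂)} Spec A` is a regular scheme as soon as the two chart rings `A[(c)/c₁]`, `A[(c)/c₂]` are, provided `c₀² = −c₁c₂`** — then `(c₁, c₂)` is a
reduction of `(c)` (`X2YGCentre.sq_le_span_mul_of_sq_eq`) and the charts at a reduction cover the blow-up (`affineBlowup.isRegular_of_isRegularRing_blowupAlgebra_of_pow_le`).
Stated over an arbitrary ring so that it applies verbatim to the `Fin 5` chart presentations of the next files. [folklore; cite: GortzWedhorn2020, Prop. 13.91 (4), (13.19)] -/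
theorem isRegular_affineBlowup_of_sq_eq_neg_mul {A : Type u} [CommRing A] (J : Ideal A) (c : Fin 3 → A) (hJ : J = Ideal.span (Set.range c))
    (hrel : c 0 ^ 2 = -(c 1 * c 2)) (h1 : IsRegularRing (blowupAlgebra J (c 1))) (h2 : IsRegularRing (blowupAlgebra J (c 2))) :
    Scheme.IsRegular (affineBlowup J) := by
  subst hJ
  refine affineBlowup.isRegular_of_isRegularRing_blowupAlgebra_of_pow_le (I := Ideal.span (Set.range c)) (![c 1, c 2]) (fun i => ?_) (N := 1)
    (X2YGCentre.sq_le_span_mul_of_sq_eq c hrel) (fun i => ?_)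
  · fin_cases i
    · exact Ideal.subset_span ⟨1, rfl⟩
    · exact Ideal.subset_span ⟨2, rfl⟩
  · fin_cases i
    · exact h1
    · exact h2

/-- ★★ **THE BLOWING UP `Bl_J Spec C` IS A REGULAR SCHEME** (`C = Λ[x′, y]/(x′² + y·g)`, `J = (x′, y, g)·C`; hypotheses as above, ANY characteristic).
[folklore; cite: Liu2002, Thm. 8.1.19 (a)] [cite: GortzWedhorn2020, Prop. 13.91 (4), (13.19)] -/
theorem isRegular_affineBlowup_strictTransform [IsRegularRing Λ] [IsDomain (Λ ⧸ Ideal.span {g})] (hg : IsSMulRegular Λ g)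
    {S₀ : Type v} [CommRing S₀] [Algebra S₀ Λ] (D₀ : Derivation S₀ Λ Λ) (hD₀ : IsUnit (Ideal.Quotient.mk (Ideal.span {g}) (D₀ g)))
    (hcen : cen = ![X 0, X 1, C g]) (hh : h = X 0 ^ 2 + X 1 * C g)
    (J : Ideal (MvPolynomial (Fin 2) Λ ⧸ Ideal.span {h})) (hJ : J = (Ideal.span (Set.range cen)).map (Ideal.Quotient.mk (Ideal.span {h}))) :
    Scheme.IsRegular (affineBlowup J) := by
  obtain ⟨r1, r2⟩ := isRegularRing_blowupAlgebra_strictTransform g cen h hg D₀ hD₀ hcen hh J hJ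
  exact isRegular_affineBlowup_of_sq_eq_neg_mul J (fun l => Ideal.Quotient.mk (Ideal.span {h}) (cen l))
    (hJ.trans (X2YGCentre.map_span_range_cen_eq cen h)) (X2YGCentre.mk_cen_zero_sq g cen h hcen hh) r1 r2

/-! ## §5 The singular locus of `C` is exactly `V(J)` -/

/-- ★ **A singular point of `C = R/(h)` contains `J`**: if `C_P` is not regular then, for `𝔓 = P ∩ R`: `C g = ∂_{T₁}h ∈ 𝔓` and `T₁·C(D₀ g) = D̃₀ h ∈ 𝔓` (Stacks 07PF,
`Derivation.apply_mem_comap_of_not_isRegularLocalRing`), so `T₁ ∈ 𝔓` (`C(D₀ g) ∈ 𝔓` is excluded by `C g ∈ 𝔓` and `D₀ g·s = 1 + g·t`), and finally `T₀ ∈ 𝔓` because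
`T₀² = h − T₁·C g ∈ 𝔓`. Characteristic-free. [cite: StacksProject, Tag 07PF] -/
theorem map_le_of_not_isRegularLocalRing [IsRegularRing Λ] {S₀ : Type v} [CommRing S₀] [Algebra S₀ Λ] (D₀ : Derivation S₀ Λ Λ)
    (hD₀ : IsUnit (Ideal.Quotient.mk (Ideal.span {g}) (D₀ g))) (hcen : cen = ![X 0, X 1, C g]) (hh : h = X 0 ^ 2 + X 1 * C g)
    (P : Ideal (MvPolynomial (Fin 2) Λ ⧸ Ideal.span {h})) [P.IsPrime] (hP : ¬ IsRegularLocalRing (Localization.AtPrime P)) :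
    (Ideal.span (Set.range cen)).map (Ideal.Quotient.mk (Ideal.span {h})) ≤ P := by
  obtain ⟨h0, h1, h2⟩ := X2YGCentre.cen_apply g cen hcen
  obtain ⟨s, t, hst⟩ := ODPCurveBlowupRegular.exists_mul_eq_one_add g D₀ hD₀
  haveI hp : (P.comap (Ideal.Quotient.mk (Ideal.span {h}))).IsPrime := Ideal.comap_isPrime _ P
  have hCg : (C g : MvPolynomial (Fin 2) Λ) ∈ P.comap (Ideal.Quotient.mk (Ideal.span {h})) := by
    have := Derivation.apply_mem_comap_of_not_isRegularLocalRing (pderiv 1 : Derivation Λ (MvPolynomial (Fin 2) Λ) (MvPolynomial (Fin 2) Λ)) h P hP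
    rwa [pderiv_one_h g h hh] at this
  have hX1 : (X 1 : MvPolynomial (Fin 2) Λ) ∈ P.comap (Ideal.Quotient.mk (Ideal.span {h})) := by
    have hw := Derivation.apply_mem_comap_of_not_isRegularLocalRing (coeffwiseDerivation (ι := Fin 2) D₀) h P hP
    rw [coeffwiseDerivation_h g h D₀ hh] at hw
    rcases hp.mem_or_mem hw with hw1 | hDg
    · exact hw1
    · exfalso
      apply hp.ne_top
      rw [Ideal.eq_top_iff_one, ← C_sub_eq_one g hst]
      exact Ideal.sub_mem _ (Ideal.mul_mem_right _ _ hDg) (Ideal.mul_mem_right _ _ hCg)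
  have hhP : h ∈ P.comap (Ideal.Quotient.mk (Ideal.span {h})) := by
    rw [Ideal.mem_comap, Ideal.Quotient.eq_zero_iff_mem.mpr (Ideal.mem_span_singleton_self h)]
    exact P.zero_mem
  have hX0 : (X 0 : MvPolynomial (Fin 2) Λ) ∈ P.comap (Ideal.Quotient.mk (Ideal.span {h})) := by
    apply hp.mem_of_pow_mem 2
    have e : (X 0 ^ 2 : MvPolynomial (Fin 2) Λ) = h - X 1 * C g := by rw [hh]; ring
    rw [e]
    exact Ideal.sub_mem _ hhP (Ideal.mul_mem_right _ _ hX1)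
  rw [Ideal.map_le_iff_le_comap, Ideal.span_le]
  rintro _ ⟨j, rfl⟩
  fin_cases j
  · exact h0 ▸ hX0
  · exact h1 ▸ hX1
  · exact h2 ▸ hCg

/-- ★ **`Sing(Spec C) = V(J)`**: for `Λ` a regular domain, `g ≠ 0`, `D₀ g` a unit modulo `g`: a prime `P` of `C = R/(h)` is a SINGULAR point iff `P ⊇ J`
(`X2YGCentre.not_isRegularLocalRing_of_le` + `map_le_of_not_isRegularLocalRing`) — the ring side of the chart identification «𝓚_Σ|_{D₊(y)} = (x′, y, w)~» on the point
floor of the (RR-I2) bed. ANY characteristic. [cite: StacksProject, Tag 07PF] [cite: Matsumura1987, Thm. 14.2] -/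
theorem not_isRegularLocalRing_iff_map_le [IsRegularRing Λ] [IsDomain Λ] (hg0 : g ≠ 0) {S₀ : Type v} [CommRing S₀] [Algebra S₀ Λ]
    (D₀ : Derivation S₀ Λ Λ) (hD₀ : IsUnit (Ideal.Quotient.mk (Ideal.span {g}) (D₀ g))) (hcen : cen = ![X 0, X 1, C g])
    (hh : h = X 0 ^ 2 + X 1 * C g) (P : Ideal (MvPolynomial (Fin 2) Λ ⧸ Ideal.span {h})) [P.IsPrime] :
    ¬ IsRegularLocalRing (Localization.AtPrime P) ↔ (Ideal.span (Set.range cen)).map (Ideal.Quotient.mk (Ideal.span {h})) ≤ P :=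
  ⟨map_le_of_not_isRegularLocalRing g cen h D₀ hD₀ hcen hh P, X2YGCentre.not_isRegularLocalRing_of_le g cen h hg0 hcen hh P⟩

/-- **The centre `J = (T₀, T₁, C g)·(R/(h))` is a prime ideal** when `Λ/(g)` is a domain: `(R/(h))/J ≅ R/I ≅ Λ/(g)` (`h ∈ I² ⊆ I`). [folklore] -/
theorem isPrime_map_span_cen [IsDomain (Λ ⧸ Ideal.span {g})] (hcen : cen = ![X 0, X 1, C g]) (hh : h = X 0 ^ 2 + X 1 * C g) :
    ((Ideal.span (Set.range cen)).map (Ideal.Quotient.mk (Ideal.span {h}))).IsPrime := by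
  haveI := X2YGCentre.isDomain_quotient g cen hcen
  haveI : (Ideal.span (Set.range cen)).IsPrime := (Ideal.Quotient.isDomain_iff_prime _).mp inferInstance
  refine Ideal.map_isPrime_of_surjective Ideal.Quotient.mk_surjective ?_
  rw [Ideal.mk_ker, Ideal.span_le, Set.singleton_subset_iff]
  exact Ideal.pow_le_self two_ne_zero (X2YGCentre.h_mem_sq g cen h hcen hh)

end Summit.ResolutionOfSingularities.ResolutionOfSingularities.Theorems.FInjectiveMacaulayfication.X2YGBlowupRegular

end
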